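import Summits.NavierStokesRegularity.TurbBounds.Certs.N1G2.EvalLattice
import HarnessLib

/-!
# Evaluator for row N1G2 (RB-N1) — the projected mode rule `M(ε; u, v)` of rbsdp SPEC §3 with a degree-6 Legendre background profile, the 8 block identities, and the
# kernel-checked FINITE CERTIFICATE of RB-N1 on the wavenumber LATTICE of the period `Γ = 2`: modes `k_m = 2π·m/Γ`, `m = 1…8` (cutoff frees `m ≥ 9`)
(cell `pub-turb` / `turb-bounds`, v2 item RB-N1-in-Lean per HOME/pub-turb-cert/RB-LEAN-V2-DESIGN.md §1 (fixed-Γ rows: 'lattice evaluator + per-period statement'); producer of THIS FILE pub-turb-cert = prover-pub-turb-cert-g8-0 (t12_evaluator_rbL.py, the LATTICE twin of gen 7's t12_evaluator_rb.py); row and source container by pub-turb-cert: `HOME/pub-turb-cert/certs/N1-canary-ra1e4-G2/rbcert.json`, rbcert/0 (k_variant lattice), sha256 `010df50c91f9f4d4…`; CERTIFIED.md row RB-N1: Ra = 10000, horizontal period Γ = 2 (d = 2; d = 3 lattices contained in `(2π/Γ)ℕ`), `Nu ≤ 3314014534153773665603/1074101633682631557120` (outward decimal 3.0853827).)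

HONEST FRAMING: rigorous bounds for the stated PDE and boundary conditions; no claim about physical turbulence beyond the bound.
FILE LAYOUT of the row-N1G2 evaluator (one namespace `Summit.NavierStokesRegularity.TurbBounds.Certs.N1G2.Evaluator` reopened across the files, every file ≤ 400 lines; the layout of gen 7's interval-cover evaluators `Certs/N1prime`, `Certs/N2prime` with the COVER files replaced by ONE lattice file): `EvalData1…7.lean` (§1–2: constants and the 14 piece matrices — DATA) → `EvalRule.lean` (§3: the rule `Mel`, its pencil forms, the real pencil `MelR` and the block-to-pencil transfer) → `EvalGramB.lean` + `EvalGrams.lean` (§4: `Bcoef ⪰ 0` by a streaming integer Gram certificate, `Acoef ⪰ 0` diagonal — the two hypotheses of the lattice transfer) → `EvalBlock<mm>.lean` ×8 (§5: one file per lattice mode, the evaluator identity `eval_m : B00m.A = den_m • Mel ε_m u_m v_m` at rbsdp's RATIONAL lattice data `(u_m, v_m) = (KINV2_m, K2_m)`, via the LIST identity `B00m.A_rows = EvalRows.lincomb (psOf …)` — `TurbBounds/EvalRows.lean`) → `EvalLattice.lean` (§6: per certified mode `m`, the mode theorem `mode_m` AT THE IRRATIONAL DATUM `K = (2πm/Γ)²`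 — `TurbBounds/RBLattice.lean`) → `Evaluator.lean` (§8: **`certificate`** for `1 ≤ m ≤ 8`; `cutoff` is in EvalData1 — the full statement of what is and is NOT kernel-checked is in THAT file's header).

WHAT IS KERNEL-CHECKED (this directory):
1. `Mel ε u v` (EvalRule) — the mode matrix rule of rbsdp SPEC 3.3–3.6 (`RBMode.block_at`), `M = a0·PW(u,v) + s·PT(v) + Σ_{p=0}^{6} ĝ_p·CE_p + T·CT(ε)`, `a0 = (s−1)/Ra`, `ĝ₀ = −s`, `ĝ_p = φ̂_p`,
   `T = s + Σ|φ̂_p|` (`T_l1`), as an explicit polynomial in the data `(u, v)` and the Young weight `ε` with the 14 literal piece matrices of EvalData1…7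
   (transcribed by the producer script `t12_evaluator_rbL.py` from generator A's own objects — rbsdp 0.4.0 `RBMode` at its NATIVE lattice data — after asserting in exact arithmetic
   that the pieces do not depend on the data, that `RBMode(Ra, Γ, m, N, P, ε_m).block_at(s, φ̂)` IS this affine rule at `(u, v) = (KINV2_m, K2_m)` for every mode, and that
   `den_m·Mel(ε_m; u_m, v_m) = Cn_m` = the matrix `A` of the staged streaming block file for all 8 blocks).
2. `eval_m` (EvalBlock files): `B00m.A = den_m • Mel ε_m u_m v_m` for every lattice mode, by a kernel `decide` on the LIST identity `B00m.A_rows = EvalRows.lincomb (psOf den_m ε_m u_m v_m)`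
   (`TurbBounds/EvalRows.lean`, gen 7) against the block modules (each certified PSD by the tree's streaming Gram certificate `GramStream` ⇒ `PSD.IsGramCertZ` ⇒ `posSemidef`).
3. `Acoef ⪰ 0` (diagonal, EvalGrams) and `Bcoef ⪰ 0` (streaming integer Gram certificate of `LB·Bcoef`, EvalGramB).
4. `mode_1 … mode_8` (EvalLattice): for each certified lattice mode, AT THE IRRATIONAL DATUM `K = (2π·m/Γ)²`, `MelR ε_m (1/K) K ⪰ 0` and both scalar tail conditions —
   rbsdp SPEC 3.2's rational relaxation made a theorem: `Klo_m = 4·PI_LO²m²/Γ² ≤ K ≤ Khi_m = 4·PI_HI²m²/Γ²` (`RBLattice.lattice_K_mem_Icc`, Mathlib's `Real.pi_gt_d20`/`pi_lt_d20`),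
   PSD at `(1/Khi_m, Klo_m)` + `Acoef, Bcoef ⪰ 0` ⇒ PSD at `(1/K, K)` (`RBLattice.posSemidef_at_enclosed_datum`, i.e. the tree's `posSemidef_pencil_on_interval_flat`, IntervalLemma.lean p243191).
5. `certificate` (this file): for every `m` with `1 ≤ m ≤ 8` there is a real `ε > 0` with `MelR ε (1/k_m²) k_m² ⪰ 0`, `16·(1/k_m²)·a0 − T·ε·λ_W ≥ 0`, `4s − T·λ_T/ε ≥ 0`
   (rbsdp SPEC 3.7/3.9; λ_W = 16/6225009, λ_T = 4/2397 at `LW = 25`, `LT = 24`); `cutoff` (EvalData1): `T² ≤ a0·s·K_c²` at `K_c = K2_9 = 1478901392381169/1849926414400` (SPEC 3.8 D1: every `k² ≥ K_c` is free);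
   `K_c_lattice` (EvalData1): `K_c ≤ (2·PI_LO·9/Γ)²` (equality), the premise of `SpectralForm.sq_lattice_ge_of_pi_lower` that puts every lattice mode `m ≥ 9` beyond the cutoff.

HOW THIS IS USED (staged with this evaluator, v2): `Results/N1G2Tail.lean` proves from `certificate` + the PROVED Legendre tail lemma R-T on the projected kept coordinates + two-sided density
that the RB-type form `∫₋₁¹ a0(16W″²/K + 8W′² + KW²) + s(4Θ′² + KΘ²) + 2(Σ_p ĝ_p P_p)WΘ ≥ 0` on `W(±1) = W′(±1) = 0`, `Θ(±1) = 0` at each certified lattice datum `K = k_m²`, and from `cutoff`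
for every `K ≥ K_c`; `Results/N1G2Spectral.lean` turns this (via gen 6's `RBSpectralLink`, `z = (x+1)/2`) into pub-turb-sos's PER-PERIOD spectral constraint
`SpectralForm.SpectralConstraintOn (periodLattice2 2) 10000 s τ′` ([cite: DingKerswell2019, (13)–(16), §5.1] in mode form, interface `spectralConstraintOn_periodLattice2_of_cutoff`)
for the background `τ′ = −1 + φ(2z−1)/s` — UNCONDITIONAL — and the cited per-period reduction (`SpectralForm.SpectralReductionOn (periodLattice2 2)`, ONE named hypothesis) then gives
`Nu(10000) ≤ 1 + Σ_p φ̂_p²/((2p+1)s) = 3314014534153773665603/1074101633682631557120 ≤ 3.0853827` for every `Γ = 2`-periodic solution (d = 2; d = 3 lattices inside `periodLattice2 2`) — row RB-N1 of HOME/CERTIFIED.md.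

NOT CHECKED HERE (LEAN-MAP items): (a) that the 14 piece matrices are rbsdp's projected Legendre–Galerkin objects for (N, P) = (16, 6) — DATA, re-derivable from SPEC 3.3–3.6 by anyone
(the staged v2 files `TailN1G2{LadderForms,Table,Mode,Pieces,Glue}.lean` prove exactly this, piece by piece, as for P2-R4 / RB-N1′); (b) the cited per-period reduction (one named hypothesis);
(c) nothing about `Ra ≠ 10000`, other periods or other backgrounds.
-/

set_option linter.style.longLine false
set_option linter.style.setOption false
set_option linter.unusedSimpArgs false
set_option maxRecDepth 100000

namespace Summit.NavierStokesRegularity.TurbBounds.Certs.N1G2.Evaluator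

open Literature.Computation.Certificates Matrix

/-! ## 8. The cutoff index and the assembled lattice certificate -/

-- The cutoff scalar `cutoff : T ^ 2 ≤ a0 * s * K_c ^ 2` (rbsdp SPEC 3.8, lemma D1) is stated in `EvalData1.lean` next to its constants (same namespace).

-- `K_c_pos : 0 < K_c` and `K_c_lattice : K_c ≤ (2·PI_LO·9/Γ)²` (the premise of `SpectralForm.sq_lattice_ge_of_pi_lower`) are stated in `EvalData1.lean` next to `K_c` (same namespace).

/-- **THE FINITE CERTIFICATE OF ROW RB-N1 ON THE LATTICE OF PERIOD Γ = 2.** For every lattice mode `m = 1 … 8` the row's mode LMI holds AT the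
irrational datum `(u, v) = (1/k_m², k_m²)`, `k_m = 2π·m/2`, for SOME Young weight `ε > 0` together with both scalar tail conditions of rbsdp SPEC 3.7:
`MelR ε (1/k_m²) k_m² ⪰ 0`, `16(1/k_m²)(s−1)/Ra − Tελ_W ≥ 0` and `4s − Tλ_T/ε ≥ 0`. Assembled from the `mode_m` theorems of `EvalLattice`; see the module docstring for what this
implies and what it does not check. -/
theorem certificate (m : ℕ) (hm : 1 ≤ m) (hm' : m ≤ 8) :
    ∃ ε : ℝ, 0 < ε ∧ (MelR ε (1 / (2 * Real.pi * (m : ℝ) / (2 : ℝ)) ^ 2) ((2 * Real.pi * (m : ℝ) / (2 : ℝ)) ^ 2) : Matrix (Fin 46) (Fin 46) ℝ).PosSemidef ∧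
      0 ≤ 16 * (1 / (2 * Real.pi * (m : ℝ) / (2 : ℝ)) ^ 2) * (a0 : ℝ) - (T : ℝ) * ε * (lamW : ℝ) ∧ 0 ≤ 4 * (s : ℝ) - (T : ℝ) * (lamT : ℝ) / ε := by
  interval_cases m
  · exact mode_1
  · exact mode_2
  · exact mode_3
  · exact mode_4
  · exact mode_5
  · exact mode_6
  · exact mode_7
  · exact mode_8

end Summit.NavierStokesRegularity.TurbBounds.Certs.N1G2.Evaluator
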